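import Literature.AnabelianGeometry.EtaleTheta.TemperedRigidity
import HarnessLib

/-!
# [EtTh] Theorem 1.6 (i): assembly and the printed characterisations the root interface does not
# carry (sub-DAG `EtTh:Thm1.6`, part 2 — rows L00(i), L02, L04, L05)

Mochizuki, *The étale theta function …*, Publ. RIMS **45** (2009), Thm. 1.6 (i), PRIMS PDF p. 24
(printed 250), with the constructions of §1 pp. 12–13, 17 it rests on [cite: MochizukiEtTh2009, Thm 1.6 p.24].
abc-iut cell, layer L2, D-0068 (1) statements-first sub-DAG (index `plan/L2/SUBDAG-EtTh-Thm16.md`;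
seat abc-iut-L6-d5, §K row K3). Companion of abc-iut-L2-t1's `TemperedRigidity.lean` (`Thm16i`) and
of `Thm16SubdagCompanion.lean` (same seat; not imported, so that the two files land independently).

Printed proof of (i), p. 24: "Assertion (i) is immediate from the definitions; the discreteness of
the topological group “Z”; and the fact that γ maps Δ^tp_{Xα} onto Δ^tp_{Xβ} [cf. [Mzk2], Lemma 1.3.8]
and preserves decomposition groups of cusps [cf. [Mzk14], Theorem 6.5, (iii)]."

PROVED: `Thm16Sub.GtpYdd_eq_GtpYN_two` (`Π^tp_Ÿ = Π^tp_{Y₂}`, p. 17), `thm16i_of_map_GtpYN_two` ((i) ⟸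
"γ(Π^tp_{Y₂,α}) = Π^tp_{Y₂,β}"), `map_GtpY_eq_of_kerToZ` ("γ(Π^tp_{Yα}) = Π^tp_{Yβ}" for EVERY
topological isomorphism, granted the printed definition of `Z`). STATED (`def … : Prop`, targets of
the sub-DAG about the root data, never asserted — NOT facts): `KerToZIsCompactlyGenerated` (L02: the
root's `toZ` is bare data, print DEFINES it from the dual graph), `GKNIsKernelOfAction` (L04: p. 13
"G_{K_N} acts trivially on (Δ^tp_X)^ell/N·(Δ^tp_Y)^ell" as a characterisation of `G_{K_N}`),
`GtpYNFromCusp` (L05: the printed construction of `Y_N` from a cusp section, which the root's axioms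
for `GtpYN` do not pin down). HONEST FRAMING: [EtTh] is refereed and undisputed; typed ≠ proved;
nothing here takes a side on [IUTchIII] Cor. 3.12.
-/

noncomputable section

namespace Literature.AnabelianGeometry.EtaleTheta

open Literature.AnabelianGeometry.SemiGraphs Topology

namespace Thm16Sub

variable {p : ℕ} [Fact p.Prime]

/-- A homeomorphic group isomorphism carries topological closures of subgroups to topological
closures (copy of `Thm16SubdagCompanion`'s lemma, kept private so the files land independently). [folklore] -/
private theorem map_topologicalClosure' {A B : Type*} [Group A] [Group B] [TopologicalSpace A]
    [TopologicalSpace B] [IsTopologicalGroup A] [IsTopologicalGroup B] (e : A ≃ₜ* B) (s : Subgroup A) :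
    s.topologicalClosure.map e.toMulEquiv.toMonoidHom = (s.map e.toMulEquiv.toMonoidHom).topologicalClosure := by
  apply SetLike.coe_injective
  change (e.toMulEquiv.toMonoidHom : A → B) '' (closure (s : Set A)) =
    closure ((e.toMulEquiv.toMonoidHom : A → B) '' (s : Set A))
  exact e.toHomeomorph.image_closure (s : Set A)

/-! ### L00(i), L02: Theorem 1.6 (i) is "γ(Π^tp_{Y₂,α}) = Π^tp_{Y₂,β}"; "γ(Π^tp_{Yα}) = Π^tp_{Yβ}" -/

section PartI

variable (D : ThetaSetting p)

/-- `Π^tp_Ÿ = Π^tp_{Y₂}`: "Ÿ = Ÿ₁ = Y₂; K̈ = K̈₁ = J̈₁ = K₂" (p. 17) — the aug-condition in `GtpYdd` is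
implied by `map_aug_GtpYN 2`. [cite: MochizukiEtTh2009, §1 p.17] -/
theorem GtpYdd_eq_GtpYN_two : D.GtpYdd = D.GtpYN 2 := by
  have h2 : (2 : ℕ+) * 1 = 2 := mul_one 2
  change D.GtpYN (2 * 1) ⊓ (D.GJddN 1).comap D.aug.toMonoidHom = D.GtpYN 2
  rw [h2, D.GJddN_one, inf_eq_left]
  intro x hx
  change D.aug.toMonoidHom x ∈ D.GKN 2
  have : D.aug.toMonoidHom x ∈ (D.GtpYN 2).map D.aug.toMonoidHom := ⟨x, hx, rfl⟩
  rw [D.map_aug_GtpYN] at this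
  exact this

/-- **L00(i).** Theorem 1.6 (i) `γ(Π^tp_{Ÿα}) = Π^tp_{Ÿβ}` ⟸ `γ(Π^tp_{Y₂,α}) = Π^tp_{Y₂,β}`.
[cite: MochizukiEtTh2009, Thm 1.6 (i) p.24] -/
theorem thm16i_of_map_GtpYN_two {Dα Dβ : ThetaSetting p} (γ : Dα.PiTemp ≃ₜ* Dβ.PiTemp)
    (hYN : (Dα.GtpYN 2).map γ.toMulEquiv.toMonoidHom = Dβ.GtpYN 2) : ThetaSetting.Thm16i γ := by
  change Dα.GtpYdd.map γ.toMulEquiv.toMonoidHom = Dβ.GtpYdd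
  rw [GtpYdd_eq_GtpYN_two, GtpYdd_eq_GtpYN_two, hYN]

/-- **L02 (statement, debt R1).** The printed DEFINITION of `Π^tp_X ↠ Z` ("the universal
graph-covering of the dual graph of this special fiber determines […] a natural surjection Π^tp_X ↠ Z
whose kernel […] Π^tp_Y", p. 12), in the group-theoretic form the proof of Thm. 1.6 (i) uses it
("immediate from the definitions; the discreteness of the topological group “Z”"): `Π^tp_Y = Ker(toZ)` is the closed subgroup
topologically generated by the COMPACT subgroups of `Π^tp_X` (the dual graph being one vertex with one
loop, `Π^tp_Y` is generated by the decomposition groups of the irreducible components, which are compact,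
and compact subgroups die in the discrete torsion-free `Z`). NOT a field of `ThetaSetting` (where `toZ`
is bare data); a statement about `D`, never asserted. [cite: MochizukiEtTh2009, §1 p.12] -/
def KerToZIsCompactlyGenerated : Prop :=
  D.GtpY = (Subgroup.closure {g : D.PiTemp | ∃ C : Subgroup D.PiTemp, IsCompact (C : Set D.PiTemp) ∧ g ∈ C}).topologicalClosure

/-- **L02.** Granted the printed definition of `Z` on both sides (`KerToZIsCompactlyGenerated`), EVERY
isomorphism of topological groups `γ : Π^tp_{Xα} ⥲ Π^tp_{Xβ}` satisfies `γ(Π^tp_{Yα}) = Π^tp_{Yβ}`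
(compact subgroups go to compact subgroups). [cite: MochizukiEtTh2009, Thm 1.6 (i) p.24] -/
theorem map_GtpY_eq_of_kerToZ {Dα Dβ : ThetaSetting p} (γ : Dα.PiTemp ≃ₜ* Dβ.PiTemp)
    (hα : KerToZIsCompactlyGenerated Dα) (hβ : KerToZIsCompactlyGenerated Dβ) :
    Dα.GtpY.map γ.toMulEquiv.toMonoidHom = Dβ.GtpY := by
  rw [hα, hβ, map_topologicalClosure', MonoidHom.map_closure]
  congr 2
  ext y
  simp only [Set.mem_image, Set.mem_setOf_eq]
  constructor
  · rintro ⟨x, ⟨C, hC, hxC⟩, rfl⟩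
    refine ⟨C.map γ.toMulEquiv.toMonoidHom, ?_, ⟨x, hxC, rfl⟩⟩
    exact hC.image γ.continuous
  · rintro ⟨C, hC, hyC⟩
    refine ⟨γ.symm y, ⟨C.map γ.symm.toMulEquiv.toMonoidHom, hC.image γ.symm.continuous,
      ⟨y, hyC, rfl⟩⟩, γ.apply_symm_apply y⟩

end PartI

/-! ### L04, L05: the two printed characterisations the root interface does not carry (statements) -/

section Statements

variable (D : ThetaSetting p)

/-- The ell-quotient map `Π^tp_X ↠ (Π^tp_X)^ell`. [cite: MochizukiEtTh2009, §1 p.12] -/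
abbrev toEll : D.PiTemp →* D.GtpEll := D.thetaToEll.comp D.toTheta

/-- `N·(Δ^tp_Y)^ell ⊆ (Π^tp_X)^ell`: the subgroup generated by the `N`-th powers of `(Δ^tp_Y)^ell`
(`(Δ^tp_Y)^ell ≅ Ẑ(1)` is abelian, p. 13). [cite: MochizukiEtTh2009, §1 p.13] -/
def ellPowersY (N : ℕ+) : Subgroup D.GtpEll :=
  Subgroup.closure ((fun y : D.GtpEll => y ^ (N : ℕ)) '' (D.DtpY.map (toEll D) : Set D.GtpEll))

/-- **L04 (statement).** "G_{K_N} acts trivially on (Δ^tp_X)^ell/N·(Δ^tp_Y)^ell" (p. 13, the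
bracketed justification of the construction of `Y_N`) read as the CHARACTERISATION the proof of
Thm. 1.6 (i) needs: an element `σ = aug(g)` of `G_K` lies in `G_{K_N} = Gal(K̄/K(ζ_N, q_X^{1/N}))`
iff conjugation by `g` acts trivially on `(Δ^tp_X)^ell` modulo `N·(Δ^tp_Y)^ell` (independent of the
lift `g`, `Δ^tp_X` acting trivially). At the model this is the Kummer theory of the Tate period `q_X`;
over the root interface it is a statement about the data `GKN`, `toZ`, `thetaToEll`, never asserted.
[cite: MochizukiEtTh2009, §1 p.13] -/
def GKNIsKernelOfAction (N : ℕ+) : Prop :=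
  ∀ g : D.PiTemp, D.aug g ∈ D.GKN N ↔
    ∀ x ∈ D.DeltaTemp, toEll D (g * x * g⁻¹ * x⁻¹) ∈ ellPowersY D N

/-- **L05 (statement, debt R2).** The printed CONSTRUCTION of `Y_N → Y` (p. 13): "any decomposition
group of a cusp of Y^log determines, up to conjugation by (Δ^tp_Y)^ell, a section G_K → (Π^tp_Y)^ell
[…] whose restriction to the open subgroup G_{K_N} ⊆ G_K determines an open immersion
G_{K_N} ↪ (Π^tp_Y)^ell/N·(Δ^tp_Y)^ell the image of which is stabilized by the conjugation action of
Π^tp_X. […] Thus, this image determines a Galois covering Y_N → Y such that the resulting surjection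
Π^tp_Y ↠ Gal(Y_N/Y), whose kernel we denote by Π^tp_{Y_N}, […]": for every
cuspidal decomposition group `Dc ⊆ Π^tp_Y`, `Π^tp_{Y_N}` is the set of `g ∈ Π^tp_Y` with
`aug(g) ∈ G_{K_N}` whose image in `(Π^tp_Y)^ell` lies in `(image of Dc ∩ aug⁻¹ G_{K_N}) · N·(Δ^tp_Y)^ell`.
The root interface carries `GtpYN` as data whose axioms (`map_aug_GtpYN`, `relIndex_deltaYN`, …) do
not single out this subgroup; a statement about `D`, never asserted. [cite: MochizukiEtTh2009, §1 p.13] -/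
def GtpYNFromCusp (N : ℕ+) : Prop :=
  ∀ Dc : Subgroup D.PiTemp, D.IsCuspidalDecompositionGroup Dc → Dc ≤ D.GtpY →
    ∀ g : D.PiTemp, g ∈ D.GtpYN N ↔
      g ∈ D.GtpY ∧ D.aug g ∈ D.GKN N ∧
        toEll D g ∈ ((Dc ⊓ (D.GKN N).comap D.aug.toMonoidHom).map (toEll D)) ⊔ ellPowersY D N

end Statements

end Thm16Sub

end Literature.AnabelianGeometry.EtaleTheta

end
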